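import Literature.MathematicalPhysics.AQFT.OSAxiomsSchwinger
import Literature.MathematicalPhysics.QuantumLattice.SchwingerOSPositivity
import Summits.QuantumFields.YangMills.Theorems.PencilRigidityDiagonalMirrorRPRStubRpClosureDensity
import HarnessLib

/-!
# `DiagonalRPClosure` (stmt-QuantumFields-17996, route TransparentRPWall): the registered stub `stub_rpOfProductPSD` — proved

Piece X_C of the BC2 redirect of `TransparentRPWall.WallDiagonalRP`, registered skeleton
`Summits/QuantumFields/QCD/Cruxes/WallDiagonalRP/Lines/DiagonalRPClosure_birth.lean` (crux-strategist, 2026-08-17), stubs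
`stub_productPSD` (the limit step) and `stub_rpOfProductPSD` (the density step).  This file lands the DENSITY STEP by name and
signature, for ANY labelled Schwinger family `S'` over `ℝ⁴`: Gram positivity on slab-ordered compact real product families
(`ProductPSD S'`, label strings carried) implies E2 (`S'.IsReflectionPositive`).  Proof = the closure argument of the landed
one-species theorem `RpClosure.isReflectionPositive_pullback` (Theorems/PencilRigidityDiagonalMirrorRPRStubRpClosure.lean) with label
strings carried: the finite-list OS form `G ↦ Σᵢⱼ 𝔖'(labᵢʳᵉᵛ ++ labⱼ)(ΘGᵢ* ⊗ Gⱼ)` is jointly continuous (`tendsto_appendTensor`,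
`continuous_osAdjoint`), is a non-negative real on products of spans of slab-ordered compact products (sesquilinear expansion
`pairing_sum_smul` + `ProductPSD` on the re-indexed finite family), and every time-ordered test function is in the closure of that
span (`RpClosure.mem_closure_span_slabOrderedCompactProducts`, landed); `{z : 0 ≤ re z, im z = 0}` is closed.
The skeleton's `E4`, `SOCP`, `ProductPSD` are reproduced VERBATIM (own namespace) so that the stub is landed by name and signature.
Width seat ym-line-sfw-p2-w2 g24 (cell ym-idea-1; free hands), `--supports stmt-QuantumFields-17996`.  HONEST FRAMING: one of the two
registered stubs; `stub_productPSD`, the item 17996 and the crux `WallDiagonalRP` remain OPEN; no rung or summit is proved; nothing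
here bears on the Yang–Mills mass gap.  [cite: OsterwalderSchrader1973, §2] [cite: GlimmJaffeQP1987, §6.1]
-/

set_option autoImplicit false

noncomputable section

namespace Summit.QuantumFields.QCD.Theorems.TransparentRPWallDiagonalRPClosure

open scoped BigOperators Topology ComplexConjugate SchwartzMap
open Filter Set Function
open Literature.MathematicalPhysics.QuantumLattice Literature.MathematicalPhysics.AQFT

/-! ## §0 The skeleton's vocabulary (VERBATIM, registered names) -/

namespace __Registered

/-- Euclidean `ℝ⁴`, time = coordinate `0`. [folklore] -/
abbrev E4 : Type := EuclideanSpace ℝ (Fin 4)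

/-- Abbreviation: the slab-ordered compact real products of the YangMills sibling (LANDED dense class). [folklore] -/
abbrev SOCP (n : ℕ) : Set 𝓢((Fin n → E4), ℂ) :=
  Summit.QuantumFields.YangMills.Cruxes.DiagonalMirrorRPR.ParityBridgeColdTraces.RpClosure.slabOrderedCompactProducts 4 n

/-- Gram positivity of a labelled family `S'` on slab-ordered compact real product families (witness form). [folklore] -/
abbrev ProductPSD {ι : Type} (S' : LabelledSchwingerFamily ι E4) : Prop :=
  ∀ (N : ℕ) (coef : Fin N → ℂ) (deg : Fin N → ℕ) (lab : (j : Fin N) → Fin (deg j) → ι)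
    (P : (j : Fin N) → 𝓢((Fin (deg j) → E4), ℂ)), (∀ j, P j ∈ SOCP (deg j)) →
      ∀ H : (i j : Fin N) → 𝓢((Fin (deg i + deg j) → E4), ℂ),
        (∀ i j, IsAppendTensorOf (H i j) (osAdjoint (P i)) (P j)) →
          let z := ∑ i, ∑ j, starRingEnd ℂ (coef i) * coef j * S' (deg i + deg j) (Fin.append (lab i ∘ Fin.rev) (lab j)) (H i j)
          0 ≤ z.re ∧ z.im = 0

end __Registered

open __Registered

/-! ## §1 Sesquilinearity of the labelled OS pairing -/

/-- Sesquilinear expansion of `T(Θ(Σ aᵢFᵢ)* ⊗ (Σ bⱼGⱼ))` for a continuous linear functional `T` on the appended test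
functions: `= Σᵢⱼ āᵢ bⱼ T(ΘFᵢ* ⊗ Gⱼ)`. [folklore] -/
theorem pairing_sum_smul {n m : ℕ} (T : 𝓢((Fin (n + m) → E4), ℂ) →L[ℂ] ℂ) {α κ : Type*} (s : Finset α) (t : Finset κ)
    (a : α → ℂ) (b : κ → ℂ) (F : α → 𝓢((Fin n → E4), ℂ)) (G : κ → 𝓢((Fin m → E4), ℂ)) :
    T ((osAdjoint (∑ i ∈ s, a i • F i)).appendTensor (∑ j ∈ t, b j • G j)) =
      ∑ i ∈ s, ∑ j ∈ t, conj (a i) * b j * T ((osAdjoint (F i)).appendTensor (G j)) := by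
  simp only [osAdjoint_sum, osAdjoint_smul, SchwartzMap.appendTensor_sum_left, SchwartzMap.appendTensor_sum_right,
    SchwartzMap.appendTensor_smul_left, SchwartzMap.appendTensor_smul_right, map_sum T, T.map_smul, smul_eq_mul,
    Finset.smul_sum]
  rw [Finset.sum_comm]
  refine Finset.sum_congr rfl fun i _ => Finset.sum_congr rfl fun j _ => ?_
  ring

/-! ## §2 The registered stub, BY NAME -/

/-- **(M) THE DENSITY STEP, any labelled family** (registered stub `stub_rpOfProductPSD` of
`Cruxes/WallDiagonalRP/Lines/DiagonalRPClosure_birth.lean`): Gram positivity on slab-ordered compact real product families implies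
E2. [cite: OsterwalderSchrader1973, §2] -/
theorem stub_rpOfProductPSD :
    ∀ (ι : Type) (S' : LabelledSchwingerFamily ι E4), ProductPSD S' → S'.IsReflectionPositive := by
  intro ι S' hP N deg lab F hF H hH z
  -- the finite-list OS form on `∏ⱼ 𝓢((ℝ⁴)^{deg j})`
  let Φ : ((j : Fin N) → 𝓢((Fin (deg j) → E4), ℂ)) → ℂ := fun G =>
    ∑ i, ∑ j, S' (deg i + deg j) (Fin.append (lab i ∘ Fin.rev) (lab j)) ((osAdjoint (G i)).appendTensor (G j))
  have hΦ : Continuous Φ := by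
    refine continuous_finsetSum _ fun i _ => continuous_finsetSum _ fun j _ => ?_
    exact continuous_iff_continuousAt.2 fun G =>
      ((S' (deg i + deg j) (Fin.append (lab i ∘ Fin.rev) (lab j))).continuous.tendsto _).comp
        (SchwartzMap.tendsto_appendTensor ((continuous_osAdjoint.tendsto (G i)).comp ((continuous_apply i).tendsto G))
          ((continuous_apply j).tendsto G))
  let C : Set ℂ := {w | 0 ≤ w.re ∧ w.im = 0}
  have hC : IsClosed C :=
    (isClosed_le continuous_const Complex.continuous_re).inter (isClosed_eq Complex.continuous_im continuous_const)
  let A : Set ((j : Fin N) → 𝓢((Fin (deg j) → E4), ℂ)) :=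
    Set.pi Set.univ fun j => (Submodule.span ℂ (SOCP (deg j)) : Set _)
  have hA : A ⊆ Φ ⁻¹' C := by
    intro G hG
    have hrep : ∀ j : Fin N, ∃ (k : ℕ) (cf : Fin k → ℂ) (v : Fin k → SOCP (deg j)),
        ∑ i, cf i • (v i : 𝓢((Fin (deg j) → E4), ℂ)) = G j :=
      fun j => Submodule.mem_span_set'.1 (hG j (Set.mem_univ j))
    choose k cf v hv using hrep
    -- re-index the finite family `(j, l)` by `Fin M`
    let e : Fin (Fintype.card (Σ j : Fin N, Fin (k j))) ≃ (Σ j : Fin N, Fin (k j)) := (Fintype.equivFin _).symm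
    have key := hP (Fintype.card (Σ j : Fin N, Fin (k j))) (fun m => cf (e m).1 (e m).2) (fun m => deg (e m).1)
      (fun m => lab (e m).1) (fun m => (v (e m).1 (e m).2 : 𝓢((Fin (deg (e m).1) → E4), ℂ))) (fun m => (v (e m).1 (e m).2).2)
      (fun m m' => (osAdjoint (v (e m).1 (e m).2 : 𝓢((Fin (deg (e m).1) → E4), ℂ))).appendTensor
        (v (e m').1 (e m').2 : 𝓢((Fin (deg (e m').1) → E4), ℂ)))
      (fun m m' => isAppendTensorOf_appendTensor _ _)
    dsimp only at key
    have hΦG : Φ G = ∑ p : (Σ j : Fin N, Fin (k j)), ∑ q : (Σ j : Fin N, Fin (k j)),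
        conj (cf p.1 p.2) * cf q.1 q.2 *
          S' (deg p.1 + deg q.1) (Fin.append (lab p.1 ∘ Fin.rev) (lab q.1))
            ((osAdjoint (v p.1 p.2 : 𝓢((Fin (deg p.1) → E4), ℂ))).appendTensor (v q.1 q.2 : 𝓢((Fin (deg q.1) → E4), ℂ))) := by
      simp only [Φ, ← hv]
      simp only [Fintype.sum_sigma]
      refine Finset.sum_congr rfl fun a _ => ?_
      rw [Finset.sum_comm]
      refine Finset.sum_congr rfl fun b _ => ?_
      exact pairing_sum_smul (S' (deg a + deg b) (Fin.append (lab a ∘ Fin.rev) (lab b))) Finset.univ Finset.univ (cf a) (cf b)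
        (fun i => (v a i : 𝓢((Fin (deg a) → E4), ℂ))) (fun i => (v b i : 𝓢((Fin (deg b) → E4), ℂ)))
    have hΦG' : Φ G = ∑ m, ∑ m', conj (cf (e m).1 (e m).2) * cf (e m').1 (e m').2 *
        S' (deg (e m).1 + deg (e m').1) (Fin.append (lab (e m).1 ∘ Fin.rev) (lab (e m').1))
          ((osAdjoint (v (e m).1 (e m).2 : 𝓢((Fin (deg (e m).1) → E4), ℂ))).appendTensor
            (v (e m').1 (e m').2 : 𝓢((Fin (deg (e m').1) → E4), ℂ))) := by
      rw [hΦG, ← Equiv.sum_comp e]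
      exact Finset.sum_congr rfl fun m _ => (Equiv.sum_comp e _).symm
    show Φ G ∈ C
    rw [hΦG']
    exact key
  have hcl : closure A ⊆ Φ ⁻¹' C := (hC.preimage hΦ).closure_subset_iff.2 hA
  have hFmem : (fun j : Fin N => F j) ∈ closure A := by
    rw [closure_pi_set]
    exact fun j _ =>
      Summit.QuantumFields.YangMills.Cruxes.DiagonalMirrorRPR.ParityBridgeColdTraces.RpClosure.mem_closure_span_slabOrderedCompactProducts
        (hF j)
  have hres : Φ (fun j => F j) ∈ C := hcl hFmem
  have hHeq : ∀ i j, H i j = (osAdjoint (F i)).appendTensor (F j) := fun i j => by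
    ext x
    rw [hH i j x, SchwartzMap.appendTensor_apply]
  have hz : z = Φ (fun j => F j) := by
    simp only [z, Φ, hHeq]
  rw [hz]
  exact hres

end Summit.QuantumFields.QCD.Theorems.TransparentRPWallDiagonalRPClosure

end
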